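import Mathlib.Algebra.Lie.Free
import Mathlib.Algebra.Lie.BaseChange
import Mathlib.Algebra.Polynomial.Coeff
import Mathlib.Algebra.Polynomial.AlgebraMap
import Mathlib.Algebra.MonoidAlgebra.Module
import Mathlib.Algebra.MonoidAlgebra.Support
import Mathlib.Algebra.FreeMonoid.Basic
import Mathlib.LinearAlgebra.Finsupp.Span
import Mathlib.RingTheory.Finiteness.Basic
import Literature.Algebra.Lie.SurfaceLieAlgebra
import HarnessLib

/-!
# The bracket-length grading of the free Lie algebra: projections, independence, finiteness

Topic `Literature/Algebra/Lie`. For the free Lie algebra `L = FreeLieAlgebra R X` the pieces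
`L_n = wordGrade R (of R) n` (span of `n`-fold brackets of letters, from
`Literature/Algebra/Lie/SurfaceLieAlgebra.lean`) form the standard `ℕ`-grading
`L = ⊕ₙ L_n`. Mathlib (pinned) has the universal property of `FreeLieAlgebra` and nothing about
its grading; this file supplies what the proof of Labute's theorem
(`Literature.Algebra.Lie.Labute1970_grSurfaceGroup`) and Witt's embedding theorem
(`Literature/Algebra/Lie/FreeLieRingEmbedding.lean`) consume:

* `degCoaction R X : L →ₗ⁅R⁆ R[t] ⊗ L`, the coaction `x ↦ t ⊗ x` on letters (so `u ↦ tⁿ ⊗ u` on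
  `L_n`, `degCoaction_of_mem`); the **projections** `gradeProj R X n : L →ₗ[R] L`
  (`= (coeff_n ⊗ id) ∘ degCoaction`): identity on `L_n`, zero on `L_m` (`m ≠ n`), values in `L_n`,
  every element is the (finite) sum of its projections (`exists_finset_sum_gradeProj`), whence the
  pieces are independent (`iSupIndep_freeLieGrade`) and the grading is internal
  (`isInternal_freeLieGrade`).
* finiteness: for finite `X` each `L_n` is a finitely generated `R`-module (`fg_freeLieGrade`).
* right-normed spanning: `L_{n+2}` is spanned by the brackets `⁅f x, u⁆`, `u ∈ L_{n+1}`
  (`wordGrade_succ_succ_le_span_lie`, `rightNormedSpan_eq_wordGrade`, for any Lie algebra and any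
  family `f`).
* the free associative algebra `T = MonoidAlgebra R (FreeMonoid X)` with the weight grading by a
  weight `wt : X → ℕ` (`wordWeight`, `magmaWeight`, pieces `tensorGrade R wt n = supported …`,
  multiplicativity `mul_mem_tensorGrade`, `lie_mem_tensorGrade`, projections `tensorProj`), the
  canonical Lie morphism `toTensor R X : L →ₗ⁅R⁆ T` (`of x ↦ single [x] 1`); `toTensor` maps `L_n`
  into `T_n` for the unit weight (`toTensor_mem_tensorGrade`) and intertwines the projections
  (`toTensor_gradeProj`).

All statements are folklore (Bourbaki, *Lie II* §2; Reutenauer, *Free Lie algebras* Ch. 0–1);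
everything is proved, there are no named facts.

## References

* N. Bourbaki, *Lie groups and Lie algebras, Ch. 2* (free Lie algebras, §2.6 graduations).
* C. Reutenauer, *Free Lie Algebras*, Oxford 1993, §1.
-/

noncomputable section

open scoped TensorProduct

namespace Literature.Algebra.Lie

/-! ## Right-normed spanning in any Lie algebra -/

section RightNormed

variable {R : Type*} [CommRing R] {X : Type*} {L : Type*} [LieRing L] [LieAlgebra R L]

/-- `⁅L_a, N⁆ ⊆ N'` propagates from generators: if `⁅f x, N_b⁆ ⊆ N_{b+1}` for all letters and all
`b`, where `N_b ⊆ L` is any family of submodules, then `⁅L_a, N_b⁆ ⊆ N_{a+b}` (`a ≥ 1`).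
Here `N_b` = span of right-normed brackets of length `b`. [folklore] -/
theorem lie_mem_of_mem_wordGrade_of_forall (f : X → L) (N : ℕ → Submodule R L)
    (hN : ∀ x b, ∀ u ∈ N b, ⁅f x, u⁆ ∈ N (b + 1)) :
    ∀ a, ∀ v ∈ wordGrade R f a, ∀ b, ∀ u ∈ N b, ⁅v, u⁆ ∈ N (a + b) := by
  intro a
  induction a using Nat.strong_induction_on with
  | _ a ih =>
  intro v hv
  refine Submodule.span_induction (p := fun v _ => ∀ b, ∀ u ∈ N b, ⁅v, u⁆ ∈ N (a + b))
    ?_ ?_ ?_ ?_ hv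
  · rintro _ ⟨w, hw, rfl⟩ b u hu
    change w.length = a at hw
    induction w using FreeMagma.recOnMul generalizing a b u with
    | ih1 x =>
      change 1 = a at hw
      subst hw
      rw [bracketWord_of, add_comm]
      exact hN x b u hu
    | ih2 w₁ w₂ _ _ =>
      change w₁.length + w₂.length = a at hw
      have h₁ := FreeMagma.length_pos w₁
      have h₂ := FreeMagma.length_pos w₂
      rw [bracketWord_mul, lie_lie]
      refine sub_mem ?_ ?_
      · have := ih w₁.length (by omega) _ (bracketWord_mem_wordGrade f w₁) _ _
          (ih w₂.length (by omega) _ (bracketWord_mem_wordGrade f w₂) b u hu)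
        rwa [← add_assoc, hw] at this
      · have := ih w₂.length (by omega) _ (bracketWord_mem_wordGrade f w₂) _ _
          (ih w₁.length (by omega) _ (bracketWord_mem_wordGrade f w₁) b u hu)
        rwa [← add_assoc, add_comm w₂.length, hw] at this
  · intro b u _; rw [zero_lie]; exact Submodule.zero_mem _
  · intro v v' _ _ hv hv' b u hu; rw [add_lie]; exact add_mem (hv b u hu) (hv' b u hu)
  · intro c v _ hv b u hu; rw [smul_lie]; exact Submodule.smul_mem _ c (hv b u hu)

/-- The span of the **right-normed** brackets `⁅f x₁, ⁅f x₂, ⋯ ⁅f x_{n-1}, f x_n⁆⋯⁆⁆` of length `n`,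
defined recursively: `RN₁ = span (range f)`, `RN_{n+1} = span {⁅f x, u⁆ | u ∈ RN_n}` (and
`RN₀ = ⊥`). [folklore] -/
def rightNormedSpan (f : X → L) : ℕ → Submodule R L
  | 0 => ⊥
  | 1 => Submodule.span R (Set.range f)
  | n + 2 => Submodule.span R {v | ∃ x, ∃ u ∈ rightNormedSpan f (n + 1), v = ⁅f x, u⁆}

/-- `⁅f x, RN_b⁆ ⊆ RN_{b+1}`. [folklore] -/
theorem lie_mem_rightNormedSpan_succ (f : X → L) (x : X) :
    ∀ b, ∀ u ∈ rightNormedSpan (R := R) f b, ⁅f x, u⁆ ∈ rightNormedSpan (R := R) f (b + 1)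
  | 0, u, hu => by
    change u ∈ (⊥ : Submodule R L) at hu
    rw [(Submodule.mem_bot R).1 hu, lie_zero]; exact Submodule.zero_mem _
  | b + 1, u, hu => Submodule.subset_span ⟨x, u, hu, rfl⟩

/-- Right-normed brackets span: `L_n ⊆ RN_n`. [folklore] -/
theorem wordGrade_le_rightNormedSpan (f : X → L) (n : ℕ) :
    wordGrade R f n ≤ rightNormedSpan (R := R) f n := by
  induction n using Nat.strong_induction_on with
  | _ n ih =>
  rcases n with _ | _ | n
  · rw [wordGrade_zero]; exact bot_le
  · rw [wordGrade_one]; exact le_of_eq rfl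
  · rw [wordGrade, Submodule.span_le]
    rintro _ ⟨w, hw, rfl⟩
    change w.length = n + 2 at hw
    induction w using FreeMagma.recOnMul with
    | ih1 x => exact absurd hw (by change (1 : ℕ) ≠ n + 2; omega)
    | ih2 w₁ w₂ _ _ =>
      change w₁.length + w₂.length = n + 2 at hw
      have h₁ := FreeMagma.length_pos w₁
      rw [bracketWord_mul]
      have key := lie_mem_of_mem_wordGrade_of_forall (R := R) f (rightNormedSpan f)
        (lie_mem_rightNormedSpan_succ f) w₁.length _ (bracketWord_mem_wordGrade f w₁) w₂.length _
        (ih w₂.length (by omega) (bracketWord_mem_wordGrade f w₂))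
      rwa [hw] at key

/-- `RN_n ⊆ L_n`. [folklore] -/
theorem rightNormedSpan_le_wordGrade (f : X → L) : ∀ n, rightNormedSpan (R := R) f n ≤ wordGrade R f n
  | 0 => bot_le
  | 1 => by rw [wordGrade_one]; exact le_of_eq rfl
  | n + 2 => by
    change Submodule.span R _ ≤ _
    rw [Submodule.span_le]
    rintro _ ⟨x, u, hu, rfl⟩
    have := lie_mem_wordGrade (mem_wordGrade_one f x) (rightNormedSpan_le_wordGrade f (n + 1) hu)
    rwa [add_comm] at this

/-- `RN_n = L_n`: the right-normed brackets of length `n` span the degree-`n` piece. [folklore] -/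
theorem rightNormedSpan_eq_wordGrade (f : X → L) (n : ℕ) :
    rightNormedSpan (R := R) f n = wordGrade R f n :=
  le_antisymm (rightNormedSpan_le_wordGrade f n) (wordGrade_le_rightNormedSpan f n)

/-- **Right-normed spanning**: `L_{n+2} ⊆ span {⁅f x, u⁆ | x ∈ X, u ∈ L_{n+1}}` (so the pieces of
degree `≥ 2` are spanned by brackets of a letter with the previous piece). [folklore] -/
theorem wordGrade_succ_succ_le_span_lie (f : X → L) (n : ℕ) :
    wordGrade R f (n + 2) ≤
      Submodule.span R {v | ∃ x, ∃ u ∈ wordGrade R f (n + 1), v = ⁅f x, u⁆} :=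
  calc wordGrade R f (n + 2) ≤ rightNormedSpan (R := R) f (n + 2) :=
        wordGrade_le_rightNormedSpan f (n + 2)
    _ ≤ _ := by
      change Submodule.span R _ ≤ _
      refine Submodule.span_mono ?_
      rintro _ ⟨x, u, hu, rfl⟩
      exact ⟨x, u, rightNormedSpan_le_wordGrade f (n + 1) hu, rfl⟩

end RightNormed

/-! ## The coaction `x ↦ t ⊗ x` and the projections of `FreeLieAlgebra R X` -/

section FreeLieGrading

variable (R : Type*) [CommRing R] (X : Type*)

/-- The degree-`n` piece `L_n` of the free Lie algebra: the span of the `n`-fold brackets of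
letters. [folklore] -/
abbrev freeLieGrade (n : ℕ) : Submodule R (FreeLieAlgebra R X) :=
  wordGrade R (FreeLieAlgebra.of R (X := X)) n

/-- The pieces span `L`. [folklore] -/
theorem iSup_freeLieGrade_eq_top : (⨆ n, freeLieGrade R X n) = ⊤ :=
  iSup_wordGrade_eq_top (lieSpan_range_freeLieAlgebraOf R X)

/-- The **degree coaction** `δ : L → R[t] ⊗_R L`, the Lie algebra morphism with `δ(x) = t ⊗ x` on
letters; it multiplies the degree-`n` piece by `tⁿ` (`degCoaction_of_mem`). [folklore] -/
def degCoaction : FreeLieAlgebra R X →ₗ⁅R⁆ Polynomial R ⊗[R] FreeLieAlgebra R X :=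
  FreeLieAlgebra.lift R fun x => (Polynomial.X : Polynomial R) ⊗ₜ[R] FreeLieAlgebra.of R x

/-- `δ(x) = t ⊗ x`. [folklore] -/
@[simp] theorem degCoaction_of (x : X) :
    degCoaction R X (FreeLieAlgebra.of R x) = (Polynomial.X : Polynomial R) ⊗ₜ[R] FreeLieAlgebra.of R x :=
  FreeLieAlgebra.lift_of_apply _ x

/-- `δ(⟦w⟧) = t^{|w|} ⊗ ⟦w⟧` for a bracket word `w`. [folklore] -/
theorem degCoaction_bracketWord (w : FreeMagma X) :
    degCoaction R X (bracketWord (FreeLieAlgebra.of R) w) =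
      ((Polynomial.X : Polynomial R) ^ w.length) ⊗ₜ[R] bracketWord (FreeLieAlgebra.of R) w := by
  induction w using FreeMagma.recOnMul with
  | ih1 x => rw [bracketWord_of, degCoaction_of]; change _ = (Polynomial.X ^ 1) ⊗ₜ[R] _; rw [pow_one]
  | ih2 u v hu hv =>
    rw [bracketWord_mul, LieHom.map_lie, hu, hv, LieAlgebra.ExtendScalars.bracket_tmul, ← pow_add]
    rfl

/-- `δ(u) = tⁿ ⊗ u` for `u ∈ L_n`. [folklore] -/
theorem degCoaction_of_mem {n : ℕ} {u : FreeLieAlgebra R X} (hu : u ∈ freeLieGrade R X n) :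
    degCoaction R X u = ((Polynomial.X : Polynomial R) ^ n) ⊗ₜ[R] u := by
  refine Submodule.span_induction ?_ ?_ ?_ ?_ hu
  · rintro _ ⟨w, hw, rfl⟩
    change w.length = n at hw
    rw [degCoaction_bracketWord, hw]
  · rw [map_zero (degCoaction R X), TensorProduct.tmul_zero]
  · intro u v _ _ hu hv; rw [map_add (degCoaction R X), hu, hv, TensorProduct.tmul_add]
  · intro c u _ hu; rw [map_smul (degCoaction R X), hu, TensorProduct.tmul_smul]

/-- `coeff_n ⊗ id : R[t] ⊗ L → L`, `p ⊗ u ↦ (coeff p n) • u`. [folklore] -/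
def coeffTensor (n : ℕ) : Polynomial R ⊗[R] FreeLieAlgebra R X →ₗ[R] FreeLieAlgebra R X :=
  TensorProduct.lift ((LinearMap.lsmul R (FreeLieAlgebra R X)).comp (Polynomial.lcoeff R n))

/-- `(coeff_n ⊗ id)(p ⊗ u) = pₙ • u`. [folklore] -/
@[simp] theorem coeffTensor_tmul (n : ℕ) (p : Polynomial R) (u : FreeLieAlgebra R X) :
    coeffTensor R X n (p ⊗ₜ[R] u) = p.coeff n • u :=
  TensorProduct.lift.tmul _ _

/-- The **projection** `π_n : L → L` onto the degree-`n` piece along the others,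
`π_n = (coeff_n ⊗ id) ∘ δ`. [folklore] -/
def gradeProj (n : ℕ) : FreeLieAlgebra R X →ₗ[R] FreeLieAlgebra R X :=
  (coeffTensor R X n).comp (degCoaction R X : FreeLieAlgebra R X →ₗ[R] _)

/-- `π_n(u) = [m = n] u` for `u ∈ L_m`. [folklore] -/
theorem gradeProj_of_mem {m n : ℕ} {u : FreeLieAlgebra R X} (hu : u ∈ freeLieGrade R X m) :
    gradeProj R X n u = if m = n then u else 0 := by
  change coeffTensor R X n (degCoaction R X u) = _
  rw [degCoaction_of_mem R X hu, coeffTensor_tmul, Polynomial.coeff_X_pow]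
  by_cases h : m = n
  · subst h; simp
  · rw [if_neg (Ne.symm h), zero_smul, if_neg h]

/-- `π_n` is the identity on `L_n`. [folklore] -/
theorem gradeProj_apply_of_mem_self {n : ℕ} {u : FreeLieAlgebra R X} (hu : u ∈ freeLieGrade R X n) :
    gradeProj R X n u = u := by
  rw [gradeProj_of_mem R X hu, if_pos rfl]

/-- `π_n` kills `L_m` for `m ≠ n`. [folklore] -/
theorem gradeProj_apply_of_mem_ne {m n : ℕ} {u : FreeLieAlgebra R X} (hu : u ∈ freeLieGrade R X m)
    (h : m ≠ n) : gradeProj R X n u = 0 := by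
  rw [gradeProj_of_mem R X hu, if_neg h]

/-- `π_n(u) ∈ L_n`. [folklore] -/
theorem gradeProj_mem (n : ℕ) (u : FreeLieAlgebra R X) : gradeProj R X n u ∈ freeLieGrade R X n := by
  have hu : u ∈ ⨆ m, freeLieGrade R X m := by rw [iSup_freeLieGrade_eq_top]; trivial
  refine Submodule.iSup_induction _ (motive := fun u => gradeProj R X n u ∈ freeLieGrade R X n) hu
    ?_ ?_ ?_
  · intro m u hu
    rw [gradeProj_of_mem R X hu]
    split_ifs with h
    · subst h; exact hu
    · exact Submodule.zero_mem _
  · rw [map_zero]; exact Submodule.zero_mem _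
  · intro u v hu hv; rw [map_add]; exact add_mem hu hv

/-- Every element is the finite sum of its homogeneous components: there is a finite set of
degrees outside which `π_n(u) = 0` and over which the `π_n(u)` sum to `u`. [folklore] -/
theorem exists_finset_sum_gradeProj (u : FreeLieAlgebra R X) :
    ∃ s : Finset ℕ, (∀ n ∉ s, gradeProj R X n u = 0) ∧ ∑ n ∈ s, gradeProj R X n u = u := by
  have hu : u ∈ ⨆ m, freeLieGrade R X m := by rw [iSup_freeLieGrade_eq_top]; trivial
  refine Submodule.iSup_induction _ (motive := fun u =>
    ∃ s : Finset ℕ, (∀ n ∉ s, gradeProj R X n u = 0) ∧ ∑ n ∈ s, gradeProj R X n u = u) hu ?_ ?_ ?_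
  · intro m u hu
    refine ⟨{m}, fun n hn => gradeProj_apply_of_mem_ne R X hu ?_, by
      rw [Finset.sum_singleton, gradeProj_apply_of_mem_self R X hu]⟩
    rintro rfl; exact hn (Finset.mem_singleton_self m)
  · exact ⟨∅, fun n _ => map_zero _, by simp⟩
  · rintro u v ⟨s, hs, hsu⟩ ⟨t, ht, htv⟩
    classical
    refine ⟨s ∪ t, fun n hn => ?_, ?_⟩
    · rw [Finset.mem_union, not_or] at hn
      rw [map_add, hs n hn.1, ht n hn.2, add_zero]
    · simp only [map_add, Finset.sum_add_distrib]
      rw [← Finset.sum_subset Finset.subset_union_left (fun n _ hn => hs n hn),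
        ← Finset.sum_subset Finset.subset_union_right (fun n _ hn => ht n hn), hsu, htv]

/-- `π_n ∘ π_m = [m = n] π_n`. [folklore] -/
theorem gradeProj_gradeProj (m n : ℕ) (u : FreeLieAlgebra R X) :
    gradeProj R X n (gradeProj R X m u) = if m = n then gradeProj R X n u else 0 := by
  rw [gradeProj_of_mem R X (gradeProj_mem R X m u)]
  split_ifs with h
  · subst h; rfl
  · rfl

/-- An element all of whose projections vanish is zero. [folklore] -/
theorem eq_zero_of_forall_gradeProj_eq_zero {u : FreeLieAlgebra R X}
    (h : ∀ n, gradeProj R X n u = 0) : u = 0 := by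
  obtain ⟨s, -, hsu⟩ := exists_finset_sum_gradeProj R X u
  rw [← hsu]
  exact Finset.sum_eq_zero fun n _ => h n

/-- The pieces `L_n` are independent. [folklore] -/
theorem iSupIndep_freeLieGrade : iSupIndep (freeLieGrade R X) := by
  refine iSupIndep_def.2 fun n => Submodule.disjoint_def.2 fun u hu hu' => ?_
  have h1 : gradeProj R X n u = u := gradeProj_apply_of_mem_self R X hu
  have h2 : gradeProj R X n u = 0 := by
    have key : (⨆ m, ⨆ (_ : m ≠ n), freeLieGrade R X m) ≤ LinearMap.ker (gradeProj R X n) :=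
      iSup₂_le fun m hm v hv => (LinearMap.mem_ker).2 (gradeProj_apply_of_mem_ne R X hv hm)
    exact (LinearMap.mem_ker).1 (key hu')
  rw [← h1, h2]

/-- **The bracket-length grading of the free Lie algebra is internal**: `L = ⊕ₙ L_n`. [folklore] -/
theorem isInternal_freeLieGrade : DirectSum.IsInternal (freeLieGrade R X) :=
  DirectSum.isInternal_submodule_of_iSupIndep_of_iSup_eq_top (iSupIndep_freeLieGrade R X)
    (iSup_freeLieGrade_eq_top R X)

/-! ### Finiteness of the pieces -/

/-- There are finitely many bracket shapes (non-associative words) of each length over a finite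
alphabet. [folklore] -/
theorem finite_setOf_length_eq [Finite X] (n : ℕ) : {w : FreeMagma X | w.length = n}.Finite := by
  induction n using Nat.strong_induction_on with
  | _ n ih =>
  have key : {w : FreeMagma X | w.length = n} ⊆ Set.range FreeMagma.of ∪
      ⋃ k ∈ Finset.range n, ⋃ (_ : 0 < k), Set.image2 (· * ·)
        {w : FreeMagma X | w.length = k} {w : FreeMagma X | w.length = n - k} := by
    intro w hw
    change w.length = n at hw
    induction w using FreeMagma.recOnMul with
    | ih1 x => exact Or.inl ⟨x, rfl⟩
    | ih2 u v _ _ =>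
      change u.length + v.length = n at hw
      have hu := FreeMagma.length_pos u
      have hv := FreeMagma.length_pos v
      refine Or.inr (Set.mem_iUnion₂.2 ⟨u.length, Finset.mem_range.2 (by omega),
        Set.mem_iUnion.2 ⟨hu, u, rfl, v, ?_, rfl⟩⟩)
      change v.length = n - u.length
      omega
  refine Set.Finite.subset ?_ key
  refine (Set.finite_range _).union (Set.Finite.biUnion (Finset.finite_toSet _) fun k hk => ?_)
  refine Set.finite_iUnion fun hk0 => Set.Finite.image2 _ (ih k (Finset.mem_range.1 hk)) (ih _ ?_)
  have := Finset.mem_range.1 hk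
  omega

/-- For a finite alphabet each piece `L_n` is a finitely generated `R`-module. [folklore] -/
theorem fg_freeLieGrade [Finite X] (n : ℕ) : (freeLieGrade R X n).FG :=
  Submodule.fg_span ((finite_setOf_length_eq X n).image _)

end FreeLieGrading

/-! ## The free associative algebra `T = R[FreeMonoid X]`, its weight grading, and `L → T` -/

section Tensor

variable (R : Type*) [CommRing R] {X : Type*}

-- Mathlib idiom: the commutator bracket on an associative algebra.
attribute [local instance 100] LieRing.ofAssociativeRing

/-- The weight `∑ wt(xᵢ)` of a word `x₁ ⋯ x_k`, as a monoid morphism to `Multiplicative ℕ`.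
[folklore] -/
def wordWeight (wt : X → ℕ) : FreeMonoid X →* Multiplicative ℕ :=
  FreeMonoid.lift fun x => Multiplicative.ofAdd (wt x)

/-- The weight of a letter. [folklore] -/
@[simp] theorem wordWeight_of (wt : X → ℕ) (x : X) :
    wordWeight wt (FreeMonoid.of x) = Multiplicative.ofAdd (wt x) := rfl

/-- The weight `∑ wt(leaf)` of a bracket shape. [folklore] -/
def magmaWeight (wt : X → ℕ) : FreeMagma X → ℕ
  | FreeMagma.of x => wt x
  | u * v => magmaWeight wt u + magmaWeight wt v

/-- Weight of a leaf. [folklore] -/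
@[simp] theorem magmaWeight_of (wt : X → ℕ) (x : X) : magmaWeight wt (FreeMagma.of x) = wt x := rfl

/-- Weight of a product. [folklore] -/
@[simp] theorem magmaWeight_mul (wt : X → ℕ) (u v : FreeMagma X) :
    magmaWeight wt (u * v) = magmaWeight wt u + magmaWeight wt v := rfl

/-- For the unit weight the weight of a shape is its length. [folklore] -/
theorem magmaWeight_one (w : FreeMagma X) : magmaWeight (fun _ => 1) w = w.length := by
  induction w using FreeMagma.recOnMul with
  | ih1 x => rfl
  | ih2 u v hu hv => rw [magmaWeight_mul, hu, hv]; rfl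

/-- The **weight-`n` piece** `T_n ⊆ R[FreeMonoid X]`: combinations of words of weight `n`.
[folklore] -/
def tensorGrade (wt : X → ℕ) (n : ℕ) : Submodule R (MonoidAlgebra R (FreeMonoid X)) :=
  MonoidAlgebra.supported R R {w | (wordWeight wt w).toAdd = n}

variable {R}

/-- Membership in `T_n`: the support consists of words of weight `n`. [folklore] -/
theorem mem_tensorGrade_iff {wt : X → ℕ} {n : ℕ} {a : MonoidAlgebra R (FreeMonoid X)} :
    a ∈ tensorGrade R wt n ↔ ∀ w ∈ a.coeff.support, (wordWeight wt w).toAdd = n := by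
  unfold tensorGrade
  rw [MonoidAlgebra.mem_supported]
  exact ⟨fun h w hw => h hw, fun h w hw => h w hw⟩

/-- A word of weight `n` (with any coefficient) lies in `T_n`. [folklore] -/
theorem single_mem_tensorGrade {wt : X → ℕ} {n : ℕ} {w : FreeMonoid X}
    (hw : (wordWeight wt w).toAdd = n) (r : R) : MonoidAlgebra.single w r ∈ tensorGrade R wt n := by
  rw [mem_tensorGrade_iff]
  intro w' hw'
  rw [MonoidAlgebra.coeff_single] at hw'
  rw [Finset.mem_singleton.1 (Finsupp.support_single_subset hw'), hw]

/-- A letter lies in `T_{wt x}`. [folklore] -/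
theorem single_of_mem_tensorGrade (wt : X → ℕ) (x : X) (r : R) :
    MonoidAlgebra.single (FreeMonoid.of x) r ∈ tensorGrade R wt (wt x) :=
  single_mem_tensorGrade (by simp) r

/-- **Multiplicativity**: `T_m · T_n ⊆ T_{m+n}`. [folklore] -/
theorem mul_mem_tensorGrade {wt : X → ℕ} {m n : ℕ} {a b : MonoidAlgebra R (FreeMonoid X)}
    (ha : a ∈ tensorGrade R wt m) (hb : b ∈ tensorGrade R wt n) : a * b ∈ tensorGrade R wt (m + n) := by
  classical
  rw [mem_tensorGrade_iff] at ha hb ⊢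
  intro w hw
  obtain ⟨u, hu, v, hv, rfl⟩ := Finset.mem_mul.1 (MonoidAlgebra.support_coeff_mul_subset a b hw)
  rw [map_mul, toAdd_mul, ha u hu, hb v hv]

/-- `T_m` bracket `T_n` lies in `T_{m+n}` (commutator bracket). [folklore] -/
theorem lie_mem_tensorGrade {wt : X → ℕ} {m n : ℕ} {a b : MonoidAlgebra R (FreeMonoid X)}
    (ha : a ∈ tensorGrade R wt m) (hb : b ∈ tensorGrade R wt n) : ⁅a, b⁆ ∈ tensorGrade R wt (m + n) := by
  rw [LieRing.of_associative_ring_bracket]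
  refine sub_mem (mul_mem_tensorGrade ha hb) ?_
  rw [add_comm]; exact mul_mem_tensorGrade hb ha

/-- The iterated commutator of a bracket shape `w` of letters lies in `T_{weight w}`. [folklore] -/
theorem bracketWord_single_mem_tensorGrade (wt : X → ℕ) (w : FreeMagma X) :
    bracketWord (fun x => MonoidAlgebra.single (FreeMonoid.of x) (1 : R)) w ∈
      tensorGrade R wt (magmaWeight wt w) := by
  induction w using FreeMagma.recOnMul with
  | ih1 x => exact single_of_mem_tensorGrade wt x 1
  | ih2 u v hu hv => rw [bracketWord_mul, magmaWeight_mul]; exact lie_mem_tensorGrade hu hv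

/-- Restriction of a finitely supported function to a decidable set, as a linear map. [folklore] -/
def finsuppFilterLinear {α : Type*} (p : α → Prop) [DecidablePred p] : (α →₀ R) →ₗ[R] (α →₀ R) :=
  { Finsupp.filterAddHom p with
    map_smul' := fun c v => by
      change Finsupp.filter p (c • v) = c • Finsupp.filter p v
      exact Finsupp.filter_smul }

/-- `finsuppFilterLinear p f = f.filter p`. [folklore] -/
@[simp] theorem finsuppFilterLinear_apply {α : Type*} (p : α → Prop) [DecidablePred p] (f : α →₀ R) :
    finsuppFilterLinear (R := R) p f = f.filter p := rfl

open Classical in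
/-- The **projection** `T → T_n` keeping the words of weight `n`. [folklore] -/
def tensorProj (wt : X → ℕ) (n : ℕ) :
    MonoidAlgebra R (FreeMonoid X) →ₗ[R] MonoidAlgebra R (FreeMonoid X) :=
  (MonoidAlgebra.coeffLinearEquiv R).symm.toLinearMap ∘ₗ
    finsuppFilterLinear (fun w => (wordWeight wt w).toAdd = n) ∘ₗ
      (MonoidAlgebra.coeffLinearEquiv R).toLinearMap

open Classical in
/-- Coefficients of the projection. [folklore] -/
theorem coeff_tensorProj (wt : X → ℕ) (n : ℕ) (a : MonoidAlgebra R (FreeMonoid X)) (w : FreeMonoid X) :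
    (tensorProj wt n a).coeff w = if (wordWeight wt w).toAdd = n then a.coeff w else 0 := by
  simp [tensorProj, Finsupp.filter_apply]

/-- `tensorProj n` is the identity on `T_n`. [folklore] -/
theorem tensorProj_apply_of_mem_self {wt : X → ℕ} {n : ℕ} {a : MonoidAlgebra R (FreeMonoid X)}
    (ha : a ∈ tensorGrade R wt n) : tensorProj wt n a = a := by
  rw [mem_tensorGrade_iff] at ha
  refine MonoidAlgebra.coeff_injective (Finsupp.ext fun w => ?_)
  rw [coeff_tensorProj]
  split_ifs with h
  · rfl
  · by_contra hne
    exact h (ha w (Finsupp.mem_support_iff.2 (Ne.symm hne)))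

/-- `tensorProj n` kills `T_m` for `m ≠ n`. [folklore] -/
theorem tensorProj_apply_of_mem_ne {wt : X → ℕ} {m n : ℕ} {a : MonoidAlgebra R (FreeMonoid X)}
    (ha : a ∈ tensorGrade R wt m) (hmn : m ≠ n) : tensorProj wt n a = 0 := by
  rw [mem_tensorGrade_iff] at ha
  refine MonoidAlgebra.coeff_injective (Finsupp.ext fun w => ?_)
  rw [coeff_tensorProj, MonoidAlgebra.coeff_zero, Finsupp.zero_apply]
  split_ifs with h
  · by_contra hne
    exact hmn ((ha w (Finsupp.mem_support_iff.2 hne)).symm.trans h)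
  · rfl

/-- `tensorProj n a ∈ T_n`. [folklore] -/
theorem tensorProj_mem (wt : X → ℕ) (n : ℕ) (a : MonoidAlgebra R (FreeMonoid X)) :
    tensorProj wt n a ∈ tensorGrade R wt n := by
  rw [mem_tensorGrade_iff]
  intro w hw
  rw [Finsupp.mem_support_iff, coeff_tensorProj] at hw
  by_contra h
  exact hw (if_neg h)

/-- An element of `T_n` whose `n`-th projection vanishes is zero. [folklore] -/
theorem eq_zero_of_mem_tensorGrade_of_tensorProj_eq_zero {wt : X → ℕ} {n : ℕ}
    {a : MonoidAlgebra R (FreeMonoid X)} (ha : a ∈ tensorGrade R wt n) (h : tensorProj wt n a = 0) :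
    a = 0 := by
  rw [← tensorProj_apply_of_mem_self ha, h]

variable (R X)

/-- The canonical Lie algebra morphism `φ : L(X) → T(X) = R[FreeMonoid X]` sending a letter to the
corresponding word of length one (the corestriction of `L → U(L) ≅ T`). [folklore] -/
def toTensor : FreeLieAlgebra R X →ₗ⁅R⁆ MonoidAlgebra R (FreeMonoid X) :=
  FreeLieAlgebra.lift R fun x => MonoidAlgebra.single (FreeMonoid.of x) 1

/-- `φ(x) = x`. [folklore] -/
@[simp] theorem toTensor_of (x : X) :
    toTensor R X (FreeLieAlgebra.of R x) = MonoidAlgebra.single (FreeMonoid.of x) 1 :=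
  FreeLieAlgebra.lift_of_apply _ x

/-- `φ` of a bracket word is the iterated commutator of the letters. [folklore] -/
theorem toTensor_bracketWord (w : FreeMagma X) :
    toTensor R X (bracketWord (FreeLieAlgebra.of R) w) =
      bracketWord (fun x => MonoidAlgebra.single (FreeMonoid.of x) (1 : R)) w := by
  rw [map_bracketWord]
  congr 1
  funext x
  exact toTensor_of R X x

/-- `φ(L_n) ⊆ T_n` (unit weight). [folklore] -/
theorem toTensor_mem_tensorGrade {n : ℕ} {u : FreeLieAlgebra R X} (hu : u ∈ freeLieGrade R X n) :
    toTensor R X u ∈ tensorGrade R (fun _ => 1) n := by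
  have key : freeLieGrade R X n ≤ (tensorGrade R (fun _ => (1 : ℕ)) n).comap
      (toTensor R X : FreeLieAlgebra R X →ₗ[R] MonoidAlgebra R (FreeMonoid X)) := by
    change Submodule.span R _ ≤ _
    rw [Submodule.span_le]
    rintro _ ⟨w, hw, rfl⟩
    change w.length = n at hw
    rw [SetLike.mem_coe, Submodule.mem_comap]
    change toTensor R X (bracketWord _ w) ∈ _
    rw [toTensor_bracketWord, ← hw, ← magmaWeight_one]
    exact bracketWord_single_mem_tensorGrade _ w
  exact key hu

/-- `φ` intertwines the projections: `φ ∘ π_n = tensorProj n ∘ φ`. [folklore] -/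
theorem toTensor_gradeProj (n : ℕ) (u : FreeLieAlgebra R X) :
    toTensor R X (gradeProj R X n u) = tensorProj (fun _ => 1) n (toTensor R X u) := by
  obtain ⟨s, hs, hsu⟩ := exists_finset_sum_gradeProj R X u
  conv_rhs => rw [← hsu]
  rw [map_sum, map_sum]
  have hterm : ∀ m, tensorProj (fun _ => (1 : ℕ)) n (toTensor R X (gradeProj R X m u)) =
      if m = n then toTensor R X (gradeProj R X n u) else 0 := by
    intro m
    split_ifs with h
    · subst h
      exact tensorProj_apply_of_mem_self (toTensor_mem_tensorGrade R X (gradeProj_mem R X m u))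
    · exact tensorProj_apply_of_mem_ne (toTensor_mem_tensorGrade R X (gradeProj_mem R X m u)) h
  simp only [hterm, Finset.sum_ite_eq']
  split_ifs with hn
  · rfl
  · rw [hs n hn, map_zero]

end Tensor

end Literature.Algebra.Lie
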